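import Literature.MathematicalPhysics.QuantumFieldTheory.OSTimeTubeDerivatives
import Literature.MathematicalPhysics.QuantumFieldTheory.OSTimeSpaceSplit
import Mathlib.Analysis.Calculus.LineDeriv.IntegrationByParts
import HarnessLib

/-!
# Time and space slices of test functions and of an OS time continuation along a temporal ray

Support file (everything proved; no definitions, no named facts) for (B)
`Literature.MathematicalPhysics.QuantumFieldTheory.OS1973_lorentzInvariant_of_timeContinuation`
(`OSTimeContinuation`; Osterwalder–Schrader I (1973), §4.2). Along a temporal ray `x + itη`
(`η` in the temporal cone, `t > 0`) an OS time continuation `𝔚` is the function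
`(u, y) ↦ 𝔚 (tsCfg (u + itη⁰) y)` of the real times `u` and spatial parts `y` of `x`
(`OSTimeTubeCoordinates`). This file collects the calculus of the slices which the proof of the
infinitesimal boost identity (`OSInfinitesimalBoost`) uses:

* the assembly map `(u, y) ↦ ((u_k, y_k))_k` is affine in `u` and in `y`
  (`exists_clm_timeEmbed`, `exists_clm_spaceEmbed`), whence the derivatives of the slices
  `u ↦ F((u, y))`, `y ↦ F((u, y))` of a differentiable `F` (`fderiv_comp_timeSpace_left`,
  `fderiv_comp_timeSpace_right`) and their compact supports;
* the expansion of the derivative of `F` along the **boost generator**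
  `(b x)_k = x_k^j e₀ + x_k⁰ e_j` in the time and space partial derivatives
  (`fderiv_apply_boostGen`);
* the line derivative of `u ↦ 𝔚 (tsCfg (u + itη⁰) y)` along `e_k` is the complex time
  derivative `∂ₖ` (`hasLineDerivAt_apply_tsCfg_rayTimes`), and the resulting **integration by
  parts in the `k`-th time** against a test function (`integral_rayTimes_mul_fderiv_time`);
* joint continuity and integrability on `ℝⁿ × (ℝ^d)ⁿ` of the time derivatives times test
  functions (`integrable_fderiv_rayTimes_mul`), for Fubini.

## References

* K. Osterwalder, R. Schrader, *Axioms for Euclidean Green's functions*, Comm. Math. Phys. 31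
  (1973) 83–112, §4.2. [OsterwalderSchraderCMP1973]
-/

noncomputable section

open Filter Complex Set MeasureTheory Metric
open scoped Topology ContDiff
open Literature.MathematicalPhysics.QuantumLattice

namespace Literature.MathematicalPhysics.QuantumFieldTheory

variable {d n : ℕ}

/-! ### The assembly map is affine in the times and in the spatial parts -/

/-- A space-time point from time and space: `(t, y) = t e₀ + (0, y)`. [folklore] -/
theorem ofTimeSpace_eq_smul_e₀_add (t : ℝ) (y : EuclideanSpace ℝ (Fin d)) :
    (ofTimeSpace t y : SpaceTime d) = t • e₀ d + ofTimeSpace 0 y := by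
  ext μ
  refine Fin.cases ?_ (fun i => ?_) μ
  · simp
  · simp [Fin.succ_ne_zero]

/-- The time embedding `u ↦ (u_k e₀)_k` as a continuous linear map. [folklore] -/
theorem exists_clm_timeEmbed :
    ∃ L : (Fin n → ℝ) →L[ℝ] (Fin n → SpaceTime d), ∀ v, L v = fun k => (v k) • e₀ d :=
  ⟨ContinuousLinearMap.pi fun k => (ContinuousLinearMap.proj k).smulRight (e₀ d), fun _ => rfl⟩

/-- The space embedding `z ↦ ((0, z_k))_k` as a continuous linear map. [folklore] -/
theorem exists_clm_spaceEmbed :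
    ∃ L : (Fin n → EuclideanSpace ℝ (Fin d)) →L[ℝ] (Fin n → SpaceTime d),
      ∀ z, L z = fun k => ofTimeSpace 0 (z k) := by
  let L₀ : EuclideanSpace ℝ (Fin d) →ₗ[ℝ] SpaceTime d :=
    { toFun := fun y => ofTimeSpace 0 y
      map_add' := fun y y' => by
        ext μ; refine Fin.cases ?_ (fun i => ?_) μ <;> simp
      map_smul' := fun c y => by
        ext μ; refine Fin.cases ?_ (fun i => ?_) μ <;> simp }
  refine ⟨ContinuousLinearMap.pi fun k => (LinearMap.toContinuousLinearMap L₀).comp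
    (ContinuousLinearMap.proj k), fun z => rfl⟩

/-- The time embedding takes `e_k` to `e₀` in the `k`-th slot. [folklore] -/
theorem timeEmbed_single (k : Fin n) :
    (fun k' => (Pi.single k (1 : ℝ) : Fin n → ℝ) k' • e₀ d) = (Pi.single k (e₀ d) : Fin n → SpaceTime d) := by
  funext k'
  by_cases h : k' = k
  · subst h; simp
  · simp [h]

/-- The space embedding takes `e_j` in the `k`-th slot to `e_{j+1}` in the `k`-th slot. [folklore] -/
theorem spaceEmbed_single (k : Fin n) (j : Fin d) :
    (fun k' => (ofTimeSpace 0 ((Pi.single k (EuclideanSpace.single j (1 : ℝ)) :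
      Fin n → EuclideanSpace ℝ (Fin d)) k') : SpaceTime d)) =
      (Pi.single k (EuclideanSpace.single j.succ (1 : ℝ)) : Fin n → SpaceTime d) := by
  funext k'
  by_cases h : k' = k
  · subst h
    simp only [Pi.single_eq_same]
    ext μ
    refine Fin.cases ?_ (fun i => ?_) μ
    · simp [Fin.succ_ne_zero]
    · simp [PiLp.single_apply, Fin.succ_inj]
  · simp only [Pi.single_eq_of_ne h]
    ext μ
    refine Fin.cases ?_ (fun i => ?_) μ <;> simp

/-- **The time slice of a differentiable function**: `u ↦ F((u_k, y_k)_k)` has derivative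
`DF ∘ (v ↦ (v_k e₀)_k)`; along `e_k` it is the partial derivative `∂_{(k,0)} F`. [folklore] -/
theorem hasFDerivAt_comp_timeSpace_left {F : (Fin n → SpaceTime d) → ℂ} (hF : Differentiable ℝ F)
    (y : Fin n → EuclideanSpace ℝ (Fin d)) (u : Fin n → ℝ) :
    ∃ L : (Fin n → ℝ) →L[ℝ] (Fin n → SpaceTime d), (∀ v, L v = fun k => (v k) • e₀ d) ∧
      HasFDerivAt (fun u : Fin n → ℝ => F fun k => ofTimeSpace (u k) (y k))
        ((fderiv ℝ F fun k => ofTimeSpace (u k) (y k)).comp L) u := by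
  obtain ⟨L, hL⟩ := exists_clm_timeEmbed (d := d) (n := n)
  refine ⟨L, hL, ?_⟩
  have hfun : (fun u : Fin n → ℝ => F fun k => ofTimeSpace (u k) (y k)) =
      fun u => F (L u + fun k => ofTimeSpace 0 (y k)) := by
    funext u
    congr 1
    funext k
    rw [hL]
    exact ofTimeSpace_eq_smul_e₀_add (u k) (y k)
  have hpt : (fun k => ofTimeSpace (u k) (y k)) = L u + fun k => ofTimeSpace 0 (y k) := by
    funext k; rw [hL]; exact ofTimeSpace_eq_smul_e₀_add (u k) (y k)
  rw [hfun, hpt]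
  exact (hF _).hasFDerivAt.comp u ((L.hasFDerivAt).add_const _)

/-- The partial derivative of the time slice along `e_k` is `∂_{(k,0)} F`. [folklore] -/
theorem fderiv_comp_timeSpace_left {F : (Fin n → SpaceTime d) → ℂ} (hF : Differentiable ℝ F)
    (y : Fin n → EuclideanSpace ℝ (Fin d)) (u : Fin n → ℝ) (k : Fin n) :
    fderiv ℝ (fun u : Fin n → ℝ => F fun k => ofTimeSpace (u k) (y k)) u (Pi.single k 1) =
      fderiv ℝ F (fun k => ofTimeSpace (u k) (y k)) (Pi.single k (e₀ d)) := by
  obtain ⟨L, hL, h⟩ := hasFDerivAt_comp_timeSpace_left hF y u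
  rw [h.fderiv, ContinuousLinearMap.comp_apply, hL, timeEmbed_single]

/-- **The space slice of a differentiable function**: `y ↦ F((u_k, y_k)_k)` has derivative
`DF ∘ (z ↦ ((0, z_k))_k)`. [folklore] -/
theorem hasFDerivAt_comp_timeSpace_right {F : (Fin n → SpaceTime d) → ℂ} (hF : Differentiable ℝ F)
    (u : Fin n → ℝ) (y : Fin n → EuclideanSpace ℝ (Fin d)) :
    ∃ L : (Fin n → EuclideanSpace ℝ (Fin d)) →L[ℝ] (Fin n → SpaceTime d),
      (∀ z, L z = fun k => ofTimeSpace 0 (z k)) ∧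
      HasFDerivAt (fun y : Fin n → EuclideanSpace ℝ (Fin d) => F fun k => ofTimeSpace (u k) (y k))
        ((fderiv ℝ F fun k => ofTimeSpace (u k) (y k)).comp L) y := by
  obtain ⟨L, hL⟩ := exists_clm_spaceEmbed (d := d) (n := n)
  refine ⟨L, hL, ?_⟩
  have hfun : (fun y : Fin n → EuclideanSpace ℝ (Fin d) => F fun k => ofTimeSpace (u k) (y k)) =
      fun y => F (L y + fun k => (u k) • e₀ d) := by
    funext y
    congr 1
    funext k
    rw [hL, Pi.add_apply, add_comm]
    exact ofTimeSpace_eq_smul_e₀_add (u k) (y k)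
  have hpt : (fun k => ofTimeSpace (u k) (y k)) = L y + fun k => (u k) • e₀ d := by
    funext k; rw [hL, Pi.add_apply, add_comm]; exact ofTimeSpace_eq_smul_e₀_add (u k) (y k)
  rw [hfun, hpt]
  exact (hF _).hasFDerivAt.comp y ((L.hasFDerivAt).add_const _)

/-- The partial derivative of the space slice along `e_j` in the `k`-th slot is `∂_{(k,j)} F`. [folklore] -/
theorem fderiv_comp_timeSpace_right {F : (Fin n → SpaceTime d) → ℂ} (hF : Differentiable ℝ F)
    (u : Fin n → ℝ) (y : Fin n → EuclideanSpace ℝ (Fin d)) (k : Fin n) (j : Fin d) :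
    fderiv ℝ (fun y : Fin n → EuclideanSpace ℝ (Fin d) => F fun k => ofTimeSpace (u k) (y k)) y
        (Pi.single k (EuclideanSpace.single j (1 : ℝ))) =
      fderiv ℝ F (fun k => ofTimeSpace (u k) (y k))
        (Pi.single k (EuclideanSpace.single j.succ (1 : ℝ))) := by
  obtain ⟨L, hL, h⟩ := hasFDerivAt_comp_timeSpace_right hF u y
  rw [h.fderiv, ContinuousLinearMap.comp_apply, hL, spaceEmbed_single]

/-- The time slices of a compactly supported function are compactly supported. [folklore] -/
theorem hasCompactSupport_comp_timeSpace_left {E : Type*} [Zero E] {F : (Fin n → SpaceTime d) → E}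
    (hFc : HasCompactSupport F) (y : Fin n → EuclideanSpace ℝ (Fin d)) :
    HasCompactSupport fun u : Fin n → ℝ => F fun k => ofTimeSpace (u k) (y k) := by
  have hcont : Continuous fun x : Fin n → SpaceTime d => fun k => x k 0 :=
    continuous_pi fun k => (EuclideanSpace.proj (0 : Fin (d + 1))).continuous.comp (continuous_apply k)
  refine HasCompactSupport.of_support_subset_isCompact (hFc.image hcont) fun u hu => ?_
  exact ⟨fun k => ofTimeSpace (u k) (y k), subset_tsupport _ hu, funext fun k => rfl⟩

/-- The space slices of a compactly supported function are compactly supported. [folklore] -/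
theorem hasCompactSupport_comp_timeSpace_right {E : Type*} [Zero E] {F : (Fin n → SpaceTime d) → E}
    (hFc : HasCompactSupport F) (u : Fin n → ℝ) :
    HasCompactSupport fun y : Fin n → EuclideanSpace ℝ (Fin d) => F fun k => ofTimeSpace (u k) (y k) := by
  have hcont : Continuous fun x : Fin n → SpaceTime d => fun k => spaceC d (x k) :=
    continuous_pi fun k => (spaceC d).continuous.comp (continuous_apply k)
  refine HasCompactSupport.of_support_subset_isCompact (hFc.image hcont) fun y hy => ?_
  exact ⟨fun k => ofTimeSpace (u k) (y k), subset_tsupport _ hy, funext fun k => by simp⟩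

/-- Functions of `(u, y)` through the assembly map with compact support in `x` have compact
support in `(u, y)`. [folklore] -/
theorem hasCompactSupport_comp_timeSpace {E : Type*} [Zero E] {F : (Fin n → SpaceTime d) → E}
    (hFc : HasCompactSupport F) :
    HasCompactSupport fun p : (Fin n → ℝ) × (Fin n → EuclideanSpace ℝ (Fin d)) =>
      F fun k => ofTimeSpace (p.1 k) (p.2 k) := by
  have hcont : Continuous fun x : Fin n → SpaceTime d =>
      ((fun k => x k 0), fun k => spaceC d (x k)) :=
    (continuous_pi fun k => (EuclideanSpace.proj (0 : Fin (d + 1))).continuous.comp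
      (continuous_apply k)).prodMk (continuous_pi fun k => (spaceC d).continuous.comp (continuous_apply k))
  refine HasCompactSupport.of_support_subset_isCompact (hFc.image hcont) fun p hp => ?_
  refine ⟨fun k => ofTimeSpace (p.1 k) (p.2 k), subset_tsupport _ hp, ?_⟩
  ext <;> simp

/-! ### The boost generator -/

/-- **The derivative along the boost generator in terms of partial derivatives**:
`DF(x)(b x) = ∑ₖ ( x_k^j ∂_{(k,0)}F(x) + x_k⁰ ∂_{(k,j)}F(x) )` for
`(b x)_k = x_k^j e₀ + x_k⁰ e_j`. [folklore] -/
theorem fderiv_apply_boostGen (F : (Fin n → SpaceTime d) → ℂ) (j : Fin d) (x : Fin n → SpaceTime d) :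
    fderiv ℝ F x (fun k => (x k j.succ) • e₀ d + (x k 0) • EuclideanSpace.single j.succ (1 : ℝ)) =
      ∑ k, (((x k j.succ : ℝ) : ℂ) * fderiv ℝ F x (Pi.single k (e₀ d)) +
        ((x k 0 : ℝ) : ℂ) * fderiv ℝ F x (Pi.single k (EuclideanSpace.single j.succ (1 : ℝ)))) := by
  have hvec : (fun k => (x k j.succ) • e₀ d + (x k 0) • EuclideanSpace.single j.succ (1 : ℝ)) =
      ∑ k, ((x k j.succ) • (Pi.single k (e₀ d) : Fin n → SpaceTime d) +
        (x k 0) • (Pi.single k (EuclideanSpace.single j.succ (1 : ℝ)) : Fin n → SpaceTime d)) := by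
    conv_lhs => rw [← Finset.univ_sum_single fun k =>
      (x k j.succ) • e₀ d + (x k 0) • EuclideanSpace.single j.succ (1 : ℝ)]
    refine Finset.sum_congr rfl fun k _ => ?_
    rw [Pi.single_add, ← Pi.single_smul', ← Pi.single_smul']
  rw [hvec, map_sum]
  refine Finset.sum_congr rfl fun k _ => ?_
  rw [map_add, map_smul, map_smul, Complex.real_smul, Complex.real_smul]

/-! ### Slices of the time continuation along a temporal ray -/

/-- The times along a temporal ray shifted in the `k`-th real time. [folklore] -/
theorem rayTimes_add_smul_single (u : Fin n → ℝ) (c : Fin n → ℂ) (s : ℝ) (k : Fin n) :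
    (fun k' => (((u + s • (Pi.single k (1 : ℝ) : Fin n → ℝ)) k' : ℝ) : ℂ) + c k') =
      (fun k' => ((u k' : ℝ) : ℂ) + c k') + (s : ℂ) • (Pi.single k (1 : ℂ) : Fin n → ℂ) := by
  funext k'
  by_cases h : k' = k
  · subst h; simp; ring
  · simp [h]

/-- The times `u + c` (real `u`, fixed `c` with `Im c` ordered positive, e.g. `c = itη⁰`) depend
continuously on `u`. [folklore] -/
theorem continuous_rayTimes (c : Fin n → ℂ) :
    Continuous fun u : Fin n → ℝ => fun k => ((u k : ℝ) : ℂ) + c k :=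
  continuous_pi fun k => (continuous_ofReal.comp (continuous_apply k)).add continuous_const

variable {𝔚 : (Fin n → Fin (d + 1) → ℂ) → ℂ}

/-- **The line derivative of the time continuation along a real time**: for times `u + c` in
`𝒯ₙ`, `u ↦ 𝔚 (tsCfg (u + c) y)` has line derivative `∂ₖ 𝔚 (u + c, y)` along `e_k`. [folklore] -/
theorem hasLineDerivAt_apply_tsCfg_rayTimes (hh : IsTimeHolomorphicOn 𝔚 (timeTube d n))
    {c : Fin n → ℂ} {u : Fin n → ℝ} (hu : (fun k => ((u k : ℝ) : ℂ) + c k) ∈ cTimeTube n)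
    (y : Fin n → EuclideanSpace ℝ (Fin d)) (k : Fin n) :
    HasLineDerivAt ℝ (fun u : Fin n → ℝ => 𝔚 (tsCfg (fun k => ((u k : ℝ) : ℂ) + c k) y))
      (fderiv ℂ (fun w => 𝔚 (tsCfg w y)) (fun k => ((u k : ℝ) : ℂ) + c k)
        (Pi.single k (1 : ℂ))) u (Pi.single k 1) := by
  have hw : (fun k => ((u k : ℝ) : ℂ) + c k) + ((0 : ℝ) : ℂ) • (Pi.single k (1 : ℂ) : Fin n → ℂ) ∈
      cTimeTube n := by simpa using hu
  have h := hasDerivAt_apply_tsCfg_add_ofReal_smul hh y hw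
  simp only [ofReal_zero, zero_smul, add_zero] at h
  show HasDerivAt (fun s : ℝ => 𝔚 (tsCfg (fun k' => (((u + s • (Pi.single k (1 : ℝ) :
    Fin n → ℝ)) k' : ℝ) : ℂ) + c k') y)) _ 0
  simp only [rayTimes_add_smul_single]
  exact h

/-- **Integration by parts in the `k`-th real time against a test function**: for times
`u + c ∈ 𝒯ₙ` for all `u` (e.g. `c = itη⁰`, `η` temporal, `t > 0`), a differentiable compactly
supported `F` and a constant `a`,
`∫ 𝔚((u+c, y)) · a ∂_{(k,0)}F((u, y)) du = −∫ ∂ₖ𝔚((u+c, y)) · a F((u, y)) du`. [folklore] -/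
theorem integral_rayTimes_mul_fderiv_time (hc : ContinuousOn 𝔚 (timeTube d n))
    (hh : IsTimeHolomorphicOn 𝔚 (timeTube d n)) {c : Fin n → ℂ}
    (hcT : ∀ u : Fin n → ℝ, (fun k => ((u k : ℝ) : ℂ) + c k) ∈ cTimeTube n)
    {F : (Fin n → SpaceTime d) → ℂ} (hF : ContDiff ℝ 1 F) (hFc : HasCompactSupport F)
    (y : Fin n → EuclideanSpace ℝ (Fin d)) (k : Fin n) (a : ℂ) :
    ∫ u : Fin n → ℝ, 𝔚 (tsCfg (fun k => ((u k : ℝ) : ℂ) + c k) y) *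
        (a * fderiv ℝ F (fun k => ofTimeSpace (u k) (y k)) (Pi.single k (e₀ d))) =
      -∫ u : Fin n → ℝ, fderiv ℂ (fun w => 𝔚 (tsCfg w y)) (fun k => ((u k : ℝ) : ℂ) + c k)
        (Pi.single k (1 : ℂ)) * (a * F (fun k => ofTimeSpace (u k) (y k))) := by
  have hFd : Differentiable ℝ F := hF.differentiable one_ne_zero
  -- continuity of the four functions of `u`
  have hVc : Continuous fun u : Fin n → ℝ => 𝔚 (tsCfg (fun k => ((u k : ℝ) : ℂ) + c k) y) :=
    (hc.tsCfg_times y).comp_continuous (continuous_rayTimes c) hcT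
  have hV'c : Continuous fun u : Fin n → ℝ => fderiv ℂ (fun w => 𝔚 (tsCfg w y))
      (fun k => ((u k : ℝ) : ℂ) + c k) (Pi.single k (1 : ℂ)) :=
    ((Literature.Analysis.Complex.SCV.continuousOn_fderiv (hh.differentiableOn_tsCfg y)
      isOpen_cTimeTube).clm_apply (continuousOn_const (c := (Pi.single k (1 : ℂ) : Fin n → ℂ))))
      |>.comp_continuous (continuous_rayTimes c) hcT
  have hGc : Continuous fun u : Fin n → ℝ => a * F (fun k => ofTimeSpace (u k) (y k)) :=
    continuous_const.mul (hF.continuous.comp (continuous_timeSpace.comp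
      (continuous_id.prodMk continuous_const)))
  have hG'c : Continuous fun u : Fin n → ℝ =>
      a * fderiv ℝ F (fun k => ofTimeSpace (u k) (y k)) (Pi.single k (e₀ d)) :=
    continuous_const.mul (((hF.continuous_fderiv one_ne_zero).comp (continuous_timeSpace.comp
      (continuous_id.prodMk continuous_const))).clm_apply continuous_const)
  have hGs : HasCompactSupport fun u : Fin n → ℝ => a * F (fun k => ofTimeSpace (u k) (y k)) :=
    (hasCompactSupport_comp_timeSpace_left hFc y).mul_left
  have hG's : HasCompactSupport fun u : Fin n → ℝ =>
      a * fderiv ℝ F (fun k => ofTimeSpace (u k) (y k)) (Pi.single k (e₀ d)) :=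
    (hasCompactSupport_comp_timeSpace_left (hFc.fderiv_apply ℝ (Pi.single k (e₀ d))) y).mul_left
  have hI1 : Integrable fun u : Fin n → ℝ => fderiv ℂ (fun w => 𝔚 (tsCfg w y))
      (fun k => ((u k : ℝ) : ℂ) + c k) (Pi.single k (1 : ℂ)) * (a * F (fun k => ofTimeSpace (u k) (y k))) :=
    (hV'c.mul hGc).integrable_of_hasCompactSupport hGs.mul_left
  have hI2 : Integrable fun u : Fin n → ℝ => 𝔚 (tsCfg (fun k => ((u k : ℝ) : ℂ) + c k) y) *
      (a * fderiv ℝ F (fun k => ofTimeSpace (u k) (y k)) (Pi.single k (e₀ d))) :=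
    (hVc.mul hG'c).integrable_of_hasCompactSupport hG's.mul_left
  have hI3 : Integrable fun u : Fin n → ℝ => 𝔚 (tsCfg (fun k => ((u k : ℝ) : ℂ) + c k) y) *
      (a * F (fun k => ofTimeSpace (u k) (y k))) :=
    (hVc.mul hGc).integrable_of_hasCompactSupport hGs.mul_left
  have h := integral_bilinear_hasLineDerivAt_right_eq_neg_left_of_integrable
    (μ := (volume : Measure (Fin n → ℝ))) (B := ContinuousLinearMap.mul ℝ ℂ) (v := Pi.single k 1)
    (f := fun u : Fin n → ℝ => 𝔚 (tsCfg (fun k => ((u k : ℝ) : ℂ) + c k) y))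
    (f' := fun u => fderiv ℂ (fun w => 𝔚 (tsCfg w y)) (fun k => ((u k : ℝ) : ℂ) + c k)
      (Pi.single k (1 : ℂ)))
    (g := fun u => a * F (fun k => ofTimeSpace (u k) (y k)))
    (g' := fun u => a * fderiv ℝ F (fun k => ofTimeSpace (u k) (y k)) (Pi.single k (e₀ d)))
    (by simpa using hI1) (by simpa using hI2) (by simpa using hI3)
    (fun u _ => hasLineDerivAt_apply_tsCfg_rayTimes hh (hcT u) y k)
    (fun u _ => by
      obtain ⟨L, hL, hLd⟩ := hasFDerivAt_comp_timeSpace_left hFd y u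
      have h1 := (hLd.hasLineDerivAt (Pi.single k 1)).const_mul a
      rw [ContinuousLinearMap.comp_apply, hL, timeEmbed_single] at h1
      exact h1)
  simpa using h

/-- **Joint integrability of time derivative times test function on `ℝⁿ × (ℝ^d)ⁿ`** (for Fubini):
`(u, y) ↦ ∂ₖ𝔚((u + c, y)) · χ(y) F((u, y))` is integrable for `χ` continuous and `F` continuous of
compact support. [folklore] -/
theorem integrable_fderiv_rayTimes_mul (hc : ContinuousOn 𝔚 (timeTube d n))
    (hh : IsTimeHolomorphicOn 𝔚 (timeTube d n)) {c : Fin n → ℂ}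
    (hcT : ∀ u : Fin n → ℝ, (fun k => ((u k : ℝ) : ℂ) + c k) ∈ cTimeTube n)
    {F : (Fin n → SpaceTime d) → ℂ} (hF : Continuous F) (hFc : HasCompactSupport F)
    {χ : (Fin n → EuclideanSpace ℝ (Fin d)) → ℂ} (hχ : Continuous χ) (v : Fin n → ℂ) :
    Integrable (fun p : (Fin n → ℝ) × (Fin n → EuclideanSpace ℝ (Fin d)) =>
      fderiv ℂ (fun w => 𝔚 (tsCfg w p.2)) (fun k => ((p.1 k : ℝ) : ℂ) + c k) v *
        (χ p.2 * F (fun k => ofTimeSpace (p.1 k) (p.2 k)))) (volume.prod volume) := by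
  have h1 : Continuous fun p : (Fin n → ℝ) × (Fin n → EuclideanSpace ℝ (Fin d)) =>
      fderiv ℂ (fun w => 𝔚 (tsCfg w p.2)) (fun k => ((p.1 k : ℝ) : ℂ) + c k) v :=
    (continuousOn_fderiv_tsCfg hc hh v).comp_continuous
      (((continuous_rayTimes c).comp continuous_fst).prodMk continuous_snd)
      fun p => ⟨hcT p.1, mem_univ _⟩
  have h2 : Continuous fun p : (Fin n → ℝ) × (Fin n → EuclideanSpace ℝ (Fin d)) =>
      χ p.2 * F (fun k => ofTimeSpace (p.1 k) (p.2 k)) :=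
    (hχ.comp continuous_snd).mul (hF.comp continuous_timeSpace)
  exact (h1.mul h2).integrable_of_hasCompactSupport
    ((hasCompactSupport_comp_timeSpace hFc).mul_left.mul_left)

end Literature.MathematicalPhysics.QuantumFieldTheory
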